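import Mathlib
import HarnessLib
import Summits.Ventures.LatticeQCDFlow.Exactness.SphereLOFlowEffectiveActionConcentration
import Summits.Ventures.LatticeQCDFlow.Exactness.LatticeBoundedDifferencesTails

/-!
# Sub-Gaussian tails of the effective action of the exact leading-order trivializing flow: `π̄{±(S_eff − E S_eff) ≥ r} ≤ exp(−2r²/(|Λ|·D²))`, `D = (12κ²υ²/(d−1))c²e^{Kc}`

HONEST FRAMING: exact (Metropolis-corrected) sampling algorithms for lattice gauge theory;
figures of merit are autocorrelation/cost numbers at stated couplings and volumes; no
continuum-physics claim.

Venture `LatticeQCDFlow` (cell pub-lqcd), topic `Exactness`; FANOUT row 7 (`s0-cpn-null`).  NEW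
WORK of the cell over this leg's `Exactness/LatticeBoundedDifferencesTails.lean` (bounded
differences ⇒ `HasSubgaussianMGF` ⇒ McDiarmid's tail form) and
`Exactness/SphereLOFlowEffectiveActionConcentration.lean` (the effective action of the exact LO flow
has bounded differences `D = (12κ²υ²/(d−1))c²e^{Kc}`, `K = 3|κ|υ/(d−1)`); nothing is cited as a
fact.  Printed counterpart, NAMED ONLY: C. McDiarmid 1989, Lemma (1.2).

## Content (E–S action, `d ≥ 2`, no self-coupling, adjoint pairs, local weight `≤ υ`, `0 ≤ c ≤ |T| + 1`)

* **`hasSubgaussianMGF_effAction_loFlow`** — the centred effective action `S_eff − E S_eff`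
  (= centred log-weight of the uncorrected flow sampler) is sub-Gaussian with variance proxy
  `|Λ|·D²/4`.
* **`measureReal_effAction_loFlow_ge_le`**, **`measureReal_effAction_loFlow_le_le`** —
  `π̄{±(S_eff − E S_eff) ≥ r} ≤ exp(−2r²/(|Λ|·D²))`: the log-weight is within
  `O(D√|Λ|) = O(c²√|Λ|)` of its mean with overwhelming probability, in every volume.

NOT CLAIMED: lower tail-probability bounds; anything about the rung's one-step map or numbers.
-/

noncomputable section

namespace Summit.Ventures.LatticeQCDFlow.Exactness

open Function Set Metric MeasureTheory NormedSpace InnerProductSpace ProbabilityTheory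
open scoped RealInnerProductSpace Topology NNReal

/-! ## §2 The effective action of the exact leading-order flow -/

section LO

variable {Λ : Type*} {E : Type*} [NormedAddCommGroup E] [InnerProductSpace ℝ E]
  [FiniteDimensional ℝ E] [Fintype Λ] [DecidableEq Λ] [MeasurableSpace E] [BorelSpace E] [Nontrivial E]
  {U : Λ → Λ → (E →L[ℝ] E)} {T : ℝ}

/-- **THE CENTRED EFFECTIVE ACTION OF THE EXACT LO FLOW IS SUB-GAUSSIAN WITH VARIANCE PROXY
`|Λ|·D²/4`**, `D = (12κ²υ²/(d−1))·c²·e^{3|κ|υc/(d−1)}`. -/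
theorem hasSubgaussianMGF_effAction_loFlow (hU0 : ∀ n, U n n = 0)
    (hUadj : ∀ m n (v w : E), ⟪U m n v, w⟫ = ⟪v, U n m w⟫) (hd : 2 ≤ Module.finrank ℝ E)
    (κ S₀ : ℝ) {υ : ℝ} (hυ : ∀ k, ∑ m, ‖U k m‖ ≤ υ) {c : ℝ} (hc0 : 0 ≤ c) (hc : c ≤ |T| + 1) :
    HasSubgaussianMGF (fun ω : Λ → sphere (0 : E) 1 =>
        (c * esAction κ S₀ U (sphereTDFlow (G := fun _ : ℝ => loFlowAction κ S₀ U)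
            (contDiff_const_family (contDiff_loFlowAction U κ S₀)) T 0 c (fun m => (ω m : E))) -
          sphereTDFlowLogJac (G := fun _ : ℝ => loFlowAction κ S₀ U)
            (contDiff_const_family (contDiff_loFlowAction U κ S₀)) T 0 c (fun m => (ω m : E))) -
        ∫ ω', (c * esAction κ S₀ U (sphereTDFlow (G := fun _ : ℝ => loFlowAction κ S₀ U)
            (contDiff_const_family (contDiff_loFlowAction U κ S₀)) T 0 c
              (fun m => ((ω' : Λ → sphere (0 : E) 1) m : E))) -
          sphereTDFlowLogJac (G := fun _ : ℝ => loFlowAction κ S₀ U)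
            (contDiff_const_family (contDiff_loFlowAction U κ S₀)) T 0 c (fun m => (ω' m : E)))
          ∂Measure.pi (fun _ : Λ => uniformSphere (volume : Measure E)))
      (Fintype.card Λ * (12 * κ ^ 2 * υ ^ 2 / ((Module.finrank ℝ E : ℝ) - 1) * c ^ 2 *
          Real.exp (3 * |κ| * υ / ((Module.finrank ℝ E : ℝ) - 1) * c)) ^ 2 / 4).toNNReal
      (Measure.pi (fun _ : Λ => uniformSphere (volume : Measure E))) := by
  have h := hasSubgaussianMGF_of_bddDiff (uniformSphere (volume : Measure E))
    (continuous_effAction_loFlow (U := U) κ S₀ c (T := T))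
    (D := fun _ : Λ => 12 * κ ^ 2 * υ ^ 2 / ((Module.finrank ℝ E : ℝ) - 1) * c ^ 2 *
      Real.exp (3 * |κ| * υ / ((Module.finrank ℝ E : ℝ) - 1) * c))
    (fun ω k v v' => effAction_loFlow_bddDiff hU0 hUadj hd κ S₀ hυ hc0 hc ω k v v')
  simpa only [Finset.sum_const, Finset.card_univ, nsmul_eq_mul] using h

/-- **UPPER TAIL OF THE EFFECTIVE ACTION (= LOG-WEIGHT) OF THE EXACT LO FLOW**: for `r ≥ 0`,
`π̄{S_eff − E S_eff ≥ r} ≤ exp(−2r²/(|Λ|·D²))` (nonempty lattice, `D > 0`). -/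
theorem measureReal_effAction_loFlow_ge_le (hU0 : ∀ n, U n n = 0)
    (hUadj : ∀ m n (v w : E), ⟪U m n v, w⟫ = ⟪v, U n m w⟫) (hd : 2 ≤ Module.finrank ℝ E)
    (κ S₀ : ℝ) {υ : ℝ} (hυ : ∀ k, ∑ m, ‖U k m‖ ≤ υ) {c : ℝ} (hc0 : 0 ≤ c) (hc : c ≤ |T| + 1)
    (hDpos : 0 < Fintype.card Λ * (12 * κ ^ 2 * υ ^ 2 / ((Module.finrank ℝ E : ℝ) - 1) * c ^ 2 *
      Real.exp (3 * |κ| * υ / ((Module.finrank ℝ E : ℝ) - 1) * c)) ^ 2)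
    {r : ℝ} (hr : 0 ≤ r) :
    (Measure.pi (fun _ : Λ => uniformSphere (volume : Measure E))).real
        {ω : Λ → sphere (0 : E) 1 | r ≤
          (c * esAction κ S₀ U (sphereTDFlow (G := fun _ : ℝ => loFlowAction κ S₀ U)
              (contDiff_const_family (contDiff_loFlowAction U κ S₀)) T 0 c (fun m => (ω m : E))) -
            sphereTDFlowLogJac (G := fun _ : ℝ => loFlowAction κ S₀ U)
              (contDiff_const_family (contDiff_loFlowAction U κ S₀)) T 0 c (fun m => (ω m : E))) -
          ∫ ω', (c * esAction κ S₀ U (sphereTDFlow (G := fun _ : ℝ => loFlowAction κ S₀ U)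
              (contDiff_const_family (contDiff_loFlowAction U κ S₀)) T 0 c
                (fun m => ((ω' : Λ → sphere (0 : E) 1) m : E))) -
            sphereTDFlowLogJac (G := fun _ : ℝ => loFlowAction κ S₀ U)
              (contDiff_const_family (contDiff_loFlowAction U κ S₀)) T 0 c (fun m => (ω' m : E)))
            ∂Measure.pi (fun _ : Λ => uniformSphere (volume : Measure E))} ≤
      Real.exp (-(2 * r ^ 2 / (Fintype.card Λ * (12 * κ ^ 2 * υ ^ 2 / ((Module.finrank ℝ E : ℝ) - 1) *
        c ^ 2 * Real.exp (3 * |κ| * υ / ((Module.finrank ℝ E : ℝ) - 1) * c)) ^ 2))) := by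
  have h := measureReal_bddDiff_ge_le (uniformSphere (volume : Measure E))
    (continuous_effAction_loFlow (U := U) κ S₀ c (T := T))
    (D := fun _ : Λ => 12 * κ ^ 2 * υ ^ 2 / ((Module.finrank ℝ E : ℝ) - 1) * c ^ 2 *
      Real.exp (3 * |κ| * υ / ((Module.finrank ℝ E : ℝ) - 1) * c))
    (fun ω k v v' => effAction_loFlow_bddDiff hU0 hUadj hd κ S₀ hυ hc0 hc ω k v v')
    (by simpa only [Finset.sum_const, Finset.card_univ, nsmul_eq_mul] using hDpos) hr
  simpa only [Finset.sum_const, Finset.card_univ, nsmul_eq_mul] using h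

/-- **LOWER TAIL**: for `r ≥ 0`, `π̄{S_eff − E S_eff ≤ −r} ≤ exp(−2r²/(|Λ|·D²))`. -/
theorem measureReal_effAction_loFlow_le_le (hU0 : ∀ n, U n n = 0)
    (hUadj : ∀ m n (v w : E), ⟪U m n v, w⟫ = ⟪v, U n m w⟫) (hd : 2 ≤ Module.finrank ℝ E)
    (κ S₀ : ℝ) {υ : ℝ} (hυ : ∀ k, ∑ m, ‖U k m‖ ≤ υ) {c : ℝ} (hc0 : 0 ≤ c) (hc : c ≤ |T| + 1)
    (hDpos : 0 < Fintype.card Λ * (12 * κ ^ 2 * υ ^ 2 / ((Module.finrank ℝ E : ℝ) - 1) * c ^ 2 *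
      Real.exp (3 * |κ| * υ / ((Module.finrank ℝ E : ℝ) - 1) * c)) ^ 2)
    {r : ℝ} (hr : 0 ≤ r) :
    (Measure.pi (fun _ : Λ => uniformSphere (volume : Measure E))).real
        {ω : Λ → sphere (0 : E) 1 |
          (c * esAction κ S₀ U (sphereTDFlow (G := fun _ : ℝ => loFlowAction κ S₀ U)
              (contDiff_const_family (contDiff_loFlowAction U κ S₀)) T 0 c (fun m => (ω m : E))) -
            sphereTDFlowLogJac (G := fun _ : ℝ => loFlowAction κ S₀ U)
              (contDiff_const_family (contDiff_loFlowAction U κ S₀)) T 0 c (fun m => (ω m : E))) -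
          ∫ ω', (c * esAction κ S₀ U (sphereTDFlow (G := fun _ : ℝ => loFlowAction κ S₀ U)
              (contDiff_const_family (contDiff_loFlowAction U κ S₀)) T 0 c
                (fun m => ((ω' : Λ → sphere (0 : E) 1) m : E))) -
            sphereTDFlowLogJac (G := fun _ : ℝ => loFlowAction κ S₀ U)
              (contDiff_const_family (contDiff_loFlowAction U κ S₀)) T 0 c (fun m => (ω' m : E)))
            ∂Measure.pi (fun _ : Λ => uniformSphere (volume : Measure E)) ≤ -r} ≤
      Real.exp (-(2 * r ^ 2 / (Fintype.card Λ * (12 * κ ^ 2 * υ ^ 2 / ((Module.finrank ℝ E : ℝ) - 1) *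
        c ^ 2 * Real.exp (3 * |κ| * υ / ((Module.finrank ℝ E : ℝ) - 1) * c)) ^ 2))) := by
  have h := measureReal_bddDiff_le_le (uniformSphere (volume : Measure E))
    (continuous_effAction_loFlow (U := U) κ S₀ c (T := T))
    (D := fun _ : Λ => 12 * κ ^ 2 * υ ^ 2 / ((Module.finrank ℝ E : ℝ) - 1) * c ^ 2 *
      Real.exp (3 * |κ| * υ / ((Module.finrank ℝ E : ℝ) - 1) * c))
    (fun ω k v v' => effAction_loFlow_bddDiff hU0 hUadj hd κ S₀ hυ hc0 hc ω k v v')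
    (by simpa only [Finset.sum_const, Finset.card_univ, nsmul_eq_mul] using hDpos) hr
  simpa only [Finset.sum_const, Finset.card_univ, nsmul_eq_mul] using h

end LO

end Summit.Ventures.LatticeQCDFlow.Exactness

end
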